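import Literature.NumberTheory.GaloisRepresentations.SerreWeightExistence
import Literature.NumberTheory.GaloisRepresentations.LocalGaloisGroupProofs
import Literature.NumberTheory.GaloisRepresentations.AbsGaloisGroupCompact
import Literature.NumberTheory.GaloisRepresentations.ArtinConductorHerbrandProofs
import Literature.NumberTheory.GaloisRepresentations.TameInertiaKummerProofs
import Mathlib.FieldTheory.PurelyInseparable.Exponent
import Mathlib.FieldTheory.Perfect
import Mathlib.NumberTheory.LocalField.Basic
import HarnessLib

/-!
# `I_F^v ↠ Gal(E/F)^v` from Herbrand's theorem in every characteristic (trunk GalRep, item C16; companion to `SerreWeightExistence.lean`)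

D-0014 keeps `Literature/` sorry-free by stating cited results as named facts `def X : Prop`.
The parent file `Literature.NumberTheory.GaloisRepresentations.SerreWeightExistence` states the
last leaf of Serre's weight recipe (`ModPGaloisRep.exists_isSerreWeight`, Serre, Duke Math. J. 54
(1987), §2.1 Prop. 1, §2.2–2.4) as the named fact
`Literature.absUpperInertia_map_absRestrictNormalHom F` — the restriction `Γ_F → Gal(E/F)` maps the
absolute upper-numbering group `I_F^v` *onto* `Gal(E/F)^v` for every finite Galois `E ⊆ F̄`
(Serre, *Local Fields*, Ch. IV §3, Prop. 14 and Remark 1) — and derives it from the tree's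
Herbrand leaf `Literature.NumberTheory.GaloisRepresentations.herbrand_quotient` **in characteristic `0` only**
(`absUpperInertia_map_absRestrictNormalHom_of_herbrand_quotient`), because the infimum defining
`I_F^v = absUpperInertia F v` (`RamificationFiltration.lean`) runs over all finite *normal*
layers `E₁ ⊆ F̄`, which in characteristic `p` may be inseparable over `F`, where Herbrand's
theorem (stated for Galois `L/K`) does not apply.

This file removes the characteristic hypothesis:

* `Literature.NumberTheory.GaloisRepresentations.absUpperInertia_map_absRestrictNormalHom_holds_of_herbrand_quotient` — for **every**
  non-archimedean local field `F`, `absUpperInertia_map_absRestrictNormalHom F` follows from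
  `herbrand_quotient` at the finite layers of `F̄` (the hypothesis `hq`, used at Galois layers
  only);
* `Literature.NumberTheory.GaloisRepresentations.ModPGaloisRep.exists_isSerreWeight_holds_of_herbrand_quotient` — hence the existence of a
  Serre weight `ρ.exists_isSerreWeight ι` for every `ρ̄ : Γ_F → GL₂(k)` from `herbrand_quotient`
  and the structure of the characters of `I_F` (`exists_eq_kummerCharacter_pow`, `TameInertia.lean`)
  alone, in every characteristic (through the parent's `ModPGaloisRep.exists_isSerreWeight_of`);
* `Literature.NumberTheory.GaloisRepresentations.absUpperInertia_map_absRestrictNormalHom_holds` — **fact D holds**: the discharge, fed with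
  the tree's `herbrand_quotient_holds` (`ArtinConductorHerbrandProofs.lean`, item C9); with the
  consequences `Literature.NumberTheory.GaloisRepresentations.absInertia_map_isCyclic_holds` (the named fact `absInertia_map_isCyclic` of
  `TameInertia.lean`: a tamely ramified continuous `f : Γ_F → H` has `f(I_F)` cyclic of order
  prime to `p`, Serre IV §2 Cor. 1 of Prop. 7) and
  `Literature.NumberTheory.GaloisRepresentations.ModPGaloisRep.exists_isSerreWeight_holds_of_kummerCharacter` (the existence of a Serre
  weight from `exists_eq_kummerCharacter_pow` alone).

## The inseparable layers (mathematics not in Serre)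

Let `E₁/F` be finite normal inside `F̄`, `E_s ⊆ E₁` the separable closure of `F` in `E₁` (finite
Galois over `F`; `E₁/E_s` purely inseparable of degree `q = p^r`, and restriction
`Gal(E₁/F) → Gal(E_s/F)` is onto).  The relative Frobenius `φ : x ↦ x^q` maps `E₁` into `E_s`,
the integral closure `𝒪_{E₁}` of `𝒪[F]` into `𝒪_{E_s}` with `φ⁻¹(𝒪_{E_s}) = 𝒪_{E₁}` and
`φ⁻¹(𝔓_{E_s}) = 𝔓_{E₁}` (primality of `𝔓 = absMaximalIdeal F`), and commutes with the Galois
actions.  **If `φ` is onto `E_s`**, it is therefore an equivariant isomorphism of pairs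
`(𝒪_{E₁}, 𝔓_{E₁}) ≅ (𝒪_{E_s}, 𝔓_{E_s})` over the bijection `Gal(E₁/F) ≅ Gal(E_s/F)`, and by
transport of structure (`upperRamificationSubgroup_comap_ringEquiv` of
`RamificationFiltrationTowerProofs.lean`) `Gal(E₁/F)^v = res⁻¹ Gal(E_s/F)^v`
(`upperRamificationSubgroup_eq_comap_restrictNormalHom_of_frobenius`): the inseparable layers
impose no new condition (`mem_absUpperInertia_of_forall_isGalois`), and the compactness argument
of `absUpperRamificationSubgroup_map_eq_of_herbrand_quotient` runs over the Galois layers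
(`absUpperInertia_map_absRestrictNormalHom_of_herbrand_quotient_of_isGalois`; compactness of
`Γ_F` in every characteristic is `absoluteGaloisGroup_compactSpace`, `AbsGaloisGroupCompact.lean`).

Surjectivity of `φ` is equivalent to `[F : F^q] = q` and is special to local fields (it fails for
complete discretely valued fields of characteristic `p` with `[F : F^p] > p`).  It is proved here
in two steps:

* `IsNonarchimedeanLocalField.exists_eq_sum_pow_mul_pow` — **`[F : F^q] ≤ q`**: with a
  uniformizer `ϖ`, every `f ∈ F` is `Σ_{j<q} g_j^q ϖ^j` (`g_j ∈ F`).  Proof: the additive map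
  `Φ(g) = Σ_j g_j^q ϖ^j` is continuous, so `Φ(𝒪[F]^q)` is compact, hence closed; it is dense in
  `𝒪[F]` because every unit is a `q`-th power modulo `𝓂[F]` (the residue field is finite of
  characteristic `p`, hence perfect: `exists_sub_pow_mem_maximalIdeal`) and
  `ϖ^k b^q = (b ϖ^m)^q ϖ^i` for `k = qm + i` (`exists_frobeniusSum_approx`); so
  `Φ(𝒪[F]^q) = 𝒪[F]`, and `F = ⋃ ϖ^{-qm} 𝒪[F]`.  (For `F = 𝔽_q((ϖ))` this is
  `F = ⊕_{j<q} F^q ϖ^j`.)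
* `IsNonarchimedeanLocalField.iterateFrobenius_surjective` — the `F`-subspace
  `W = {x ∈ F̄ : x^q ∈ E_s}` contains `E₁` and is spanned by the `[E_s : F] · q ≤ [E₁ : F]`
  vectors `b_i^{1/q} ϖ^{j/q}` (`b_i` an `F`-basis of `E_s`), so `W = E₁` and the `q`-th roots
  of the elements of `E_s` lie in `E₁`.  Here `q = p^r` with `r = log_p [E₁ : E_s]`, which
  bounds the exponent of `E₁/E_s` (`IsPurelyInseparable.exponent_le_log_finrank`), and `φ` is
  Mathlib's `IsPurelyInseparable.iterateFrobenius`.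

In characteristic `0` all of this is vacuous (`E_s = E₁`, `q = 1`), and the statements below
specialise to the parent's `absUpperInertia_map_absRestrictNormalHom_of_herbrand_quotient` and
`ModPGaloisRep.exists_isSerreWeight_of_herbrand_quotient`.

## `exists_isSerreWeight_holds`

The only hypothesis of `ModPGaloisRep.exists_isSerreWeight_holds_of_kummerCharacter` is the tree's
named fact `Literature.NumberTheory.GaloisRepresentations.exists_eq_kummerCharacter_pow` (`TameInertia.lean`: the continuous characters of
`I_F` of order prime to `p` are powers of the Kummer character, Serre, Invent. Math. 15 (1972),
§1.3 Prop. 2 and §1.7 Prop. 5), discharged in `TameInertiaKummerProofs.lean`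
(`exists_eq_kummerCharacter_pow_holds`); `Literature.NumberTheory.GaloisRepresentations.ModPGaloisRep.exists_isSerreWeight_holds` — **the
named fact `ModPGaloisRep.exists_isSerreWeight` of `SerreWeight.lean` holds** — is their
application.

## References

* [SerreLocalFields1979] J.-P. Serre, *Local Fields*, GTM 67, Springer 1979, Ch. IV §3, Prop. 14
  and Remark 1 (`G^v` of an infinite extension as `lim← G(L'/K)^v`); Ch. II §4 (structure of
  complete fields of equal characteristic: `F ≅ 𝔽_q((T))`, whence `[F : F^p] = p`).
* [Serre1987] J.-P. Serre, *Sur les représentations modulaires de degré 2 de `Gal(ℚ̄/ℚ)`*, Duke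
  Math. J. 54 (1987), §2.1 Prop. 1, §2.2–2.4.
* [NeukirchANT1999] J. Neukirch, *Algebraic Number Theory*, Springer 1999, Ch. II (10.7).

## Mathlib search

Mathlib has the relative Frobenius of a purely inseparable extension with exponent
(`IsPurelyInseparable.iterateFrobenius`, `Mathlib/FieldTheory/PurelyInseparable/Exponent.lean`),
`separableClosure.isGalois`, `IntermediateField.lift_restrict`, perfect finite fields
(`PerfectRing.ofFiniteOfIsReduced`, `bijective_iterateFrobenius`), `IsAdicComplete 𝓂[K] 𝒪[K]`
and `CompactSpace 𝒪[K]` for `IsNonarchimedeanLocalField`; it has no `p`-basis / `[K : K^p]`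
results for local fields (grep `rank.*frobenius`, `pBasis`: no hits) and no ramification groups
of local fields.  Nothing below duplicates a tree declaration (`lean search` for `frobeniusSum`,
`iterateFrobenius_surjective`, `exponent_le_log_finrank`, `mem_integralClosure_iff_frobenius`: no
hits).  The file declares no `def`s.
-/

noncomputable section

open ValuativeRel Filter Topology

namespace Literature.NumberTheory.GaloisRepresentations
namespace IsNonarchimedeanLocalField

/-! ### Part I: `[F : F^q] ≤ q` for a non-archimedean local field -/

section FrobeniusSum

variable {F : Type*} [Field F] (p : ℕ) (n : ℕ) (ϖ : F)

/-! Throughout, `Φ_ϖ(g) = Σ_{j < q} g_j^q ϖ^j` (`q = p^n`, `p` the exponential characteristic)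
is written out as `∑ j, g j ^ p ^ n * ϖ ^ (j : ℕ)`. -/

/-- `Φ_ϖ` is additive (`(a + b)^q = a^q + b^q` in exponential characteristic `p`). [folklore] -/
theorem frobeniusSum_add [ExpChar F p] (g h : Fin (p ^ n) → F) :
    ∑ j, (g + h) j ^ p ^ n * ϖ ^ (j : ℕ) =
      ∑ j, g j ^ p ^ n * ϖ ^ (j : ℕ) + ∑ j, h j ^ p ^ n * ϖ ^ (j : ℕ) := by
  simp only [Pi.add_apply, add_pow_expChar_pow, add_mul, Finset.sum_add_distrib]

/-- `Φ_ϖ(0) = 0`. [folklore] -/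
theorem frobeniusSum_zero [ExpChar F p] :
    ∑ j, (0 : Fin (p ^ n) → F) j ^ p ^ n * ϖ ^ (j : ℕ) = 0 := by
  simp [zero_pow (expChar_pow_pos F p n).ne']

/-- `Φ_ϖ` on a coordinate vector: `Φ_ϖ(b e_i) = b^q ϖ^i`. [folklore] -/
theorem frobeniusSum_single [ExpChar F p] (i : Fin (p ^ n)) (b : F) :
    ∑ j, (Pi.single i b : Fin (p ^ n) → F) j ^ p ^ n * ϖ ^ (j : ℕ) = b ^ p ^ n * ϖ ^ (i : ℕ) := by
  classical
  rw [Finset.sum_eq_single i]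
  · simp
  · intro j _ hj
    simp [Pi.single_eq_of_ne hj, zero_pow (expChar_pow_pos F p n).ne']
  · intro h
    exact absurd (Finset.mem_univ i) h

/-- `Φ_ϖ` is `F^q`-semilinear: `Φ_ϖ(c g) = c^q Φ_ϖ(g)`. [folklore] -/
theorem frobeniusSum_mul (c : F) (g : Fin (p ^ n) → F) :
    ∑ j, (c * g j) ^ p ^ n * ϖ ^ (j : ℕ) = c ^ p ^ n * ∑ j, g j ^ p ^ n * ϖ ^ (j : ℕ) := by
  simp only [mul_pow, Finset.mul_sum, mul_assoc]

/-- `Φ_ϖ` is continuous (a polynomial map). [folklore] -/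
theorem continuous_frobeniusSum [TopologicalSpace F] [IsTopologicalRing F] :
    Continuous fun g : Fin (p ^ n) → F => ∑ j, g j ^ p ^ n * ϖ ^ (j : ℕ) :=
  continuous_finsetSum _ fun j _ => ((continuous_apply j).pow _).mul continuous_const

end FrobeniusSum

section Local

variable {F : Type*} [Field F] [ValuativeRel F] [TopologicalSpace F] [IsNonarchimedeanLocalField F]
variable (p : ℕ) [ExpChar F p] (n : ℕ)

/-- **Residue digits.**  Every `u ∈ 𝒪[F]` is a `q`-th power modulo `𝓂[F]` (`q = p^n`): the
residue field is finite of characteristic `p`, hence perfect. [folklore] -/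
theorem exists_sub_pow_mem_maximalIdeal (u : 𝒪[F]) : ∃ b : 𝒪[F], u - b ^ p ^ n ∈ 𝓂[F] := by
  rcases ‹ExpChar F p› with _ | ⟨hp⟩
  · exact ⟨u, by simp⟩
  · haveI := Fact.mk hp
    haveI : CharP 𝒪[F] p := (𝒪[F]).subtype.charP Subtype.val_injective p
    haveI : CharP 𝓀[F] p := by
      rw [CharP.charP_iff_prime_eq_zero hp]
      have h : ((p : 𝒪[F]) : 𝒪[F]) = 0 := CharP.cast_eq_zero _ p
      rw [← map_natCast (IsLocalRing.residue 𝒪[F]) p, h, map_zero]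
    haveI : ExpChar 𝓀[F] p := ExpChar.prime hp
    obtain ⟨c, hc⟩ := (bijective_iterateFrobenius 𝓀[F] p n).2 (IsLocalRing.residue 𝒪[F] u)
    obtain ⟨b, rfl⟩ := IsLocalRing.residue_surjective c
    refine ⟨b, ?_⟩
    rw [← IsLocalRing.residue_eq_zero_iff, map_sub, map_pow, ← hc, iterateFrobenius_def, sub_self]

/-- One more digit: if `y = Φ(g) + ϖ^k u` with `g, u` integral then `y = Φ(g') + ϖ^{k+1} u'` with
`g', u'` integral. [folklore] -/
theorem exists_frobeniusSum_approx {ϖ : 𝒪[F]} (hϖ : Irreducible ϖ) (y : 𝒪[F]) (k : ℕ) :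
    ∃ g : Fin (p ^ n) → F, (∀ j, g j ∈ 𝒪[F]) ∧ ∃ u : 𝒪[F],
      (y : F) = ∑ j, g j ^ p ^ n * (ϖ : F) ^ (j : ℕ) + (ϖ : F) ^ k * u := by
  induction k with
  | zero => exact ⟨0, fun _ => zero_mem _, y, by simp [zero_pow (expChar_pow_pos F p n).ne']⟩
  | succ k ih =>
    obtain ⟨g, hg, u, hy⟩ := ih
    obtain ⟨b, hb⟩ := exists_sub_pow_mem_maximalIdeal p n u
    rw [hϖ.maximalIdeal_eq, Ideal.mem_span_singleton'] at hb
    obtain ⟨u', hu'⟩ := hb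
    have hq : 0 < p ^ n := expChar_pow_pos F p n
    set i : Fin (p ^ n) := ⟨k % p ^ n, Nat.mod_lt _ hq⟩ with hi
    refine ⟨g + Pi.single i ((b : F) * (ϖ : F) ^ (k / p ^ n)), fun j => ?_, u', ?_⟩
    · rw [Pi.add_apply]
      refine add_mem (hg j) ?_
      by_cases hj : j = i
      · subst hj
        rw [Pi.single_eq_same]
        exact mul_mem b.2 (pow_mem ϖ.2 _)
      · rw [Pi.single_eq_of_ne hj]
        exact zero_mem _
    · rw [frobeniusSum_add, frobeniusSum_single, hy]
      have hu : (u : F) = (b : F) ^ p ^ n + (ϖ : F) * u' := by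
        have := congrArg (fun z : 𝒪[F] => (z : F)) hu'
        simp only [Subring.coe_mul, AddSubgroupClass.coe_sub, SubmonoidClass.coe_pow] at this
        linear_combination -this
      rw [hu, mul_pow, ← pow_mul, show (i : ℕ) = k % p ^ n from rfl]
      have hk : k / p ^ n * p ^ n + k % p ^ n = k := Nat.div_add_mod' k (p ^ n)
      rw [mul_assoc, ← pow_add, hk, pow_succ]
      ring

/-- **`[F : F^q] ≤ q`: integral case.**  Every `y ∈ 𝒪[F]` is `Σ_{j<q} g_j^q ϖ^j` with
`g_j ∈ 𝒪[F]` (compactness of `𝒪[F]^q` and density of the image of `Φ_ϖ`). [folklore] -/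
theorem exists_frobeniusSum_eq_of_mem {ϖ : 𝒪[F]} (hϖ : Irreducible ϖ) (y : 𝒪[F]) :
    ∃ g : Fin (p ^ n) → F, (∀ j, g j ∈ 𝒪[F]) ∧ ∑ j, g j ^ p ^ n * (ϖ : F) ^ (j : ℕ) = y := by
  -- `Φ = Φ_ϖ`
  set Φ : (Fin (p ^ n) → F) → F := fun g => ∑ j, g j ^ p ^ n * (ϖ : F) ^ (j : ℕ) with hΦ
  haveI : T2Space F := by
    letI := IsTopologicalAddGroup.rightUniformSpace F
    haveI := isUniformAddGroup_of_addCommGroup (G := F)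
    infer_instance
  -- the compact set `𝒪^q` and its closed image
  set K : Set (Fin (p ^ n) → F) := Set.univ.pi fun _ => (𝒪[F] : Set F) with hK
  have hKc : IsCompact K := isCompact_univ_pi fun _ => IsNonarchimedeanLocalField.isCompact_closedBall F 1
  have hVc : IsClosed (Φ '' K) := (hKc.image (continuous_frobeniusSum p n _)).isClosed
  -- approximations
  choose g hg u hu using exists_frobeniusSum_approx (p := p) (n := n) hϖ y
  have hmemK : ∀ k, g k ∈ K := fun k => Set.mem_univ_pi.mpr fun j => hg k j
  -- `ϖ^k u_k → 0`
  have hϖ1 : valuation F (ϖ : F) < 1 :=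
    Valuation.Integer.not_isUnit_iff_valuation_lt_one.mp hϖ.not_isUnit
  have htend : Tendsto (fun k => Φ (g k)) atTop (𝓝 (y : F)) := by
    have h0 : Tendsto (fun k => (ϖ : F) ^ k * (u k : F)) atTop (𝓝 0) := by
      rw [(IsValuativeTopology.hasBasis_nhds (0 : F)).tendsto_right_iff]
      intro γ _
      obtain ⟨k₀, hk₀⟩ := exists_pow_lt₀ hϖ1 γ
      refine eventually_atTop.mpr ⟨k₀, fun k hk => ?_⟩
      simp only [Set.mem_setOf_eq, sub_zero, map_mul, map_pow]
      calc valuation F (ϖ : F) ^ k * valuation F (u k : F)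
          ≤ valuation F (ϖ : F) ^ k * 1 :=
            mul_le_mul_right ((Valuation.mem_integer_iff _ _).mp (u k).2) _
        _ = valuation F (ϖ : F) ^ k := mul_one _
        _ ≤ valuation F (ϖ : F) ^ k₀ := pow_le_pow_right_of_le_one' hϖ1.le hk
        _ < γ := hk₀
    have h1 : Tendsto (fun k => (y : F) - (ϖ : F) ^ k * (u k : F)) atTop (𝓝 ((y : F) - 0)) :=
      tendsto_const_nhds.sub h0
    rw [sub_zero] at h1
    refine h1.congr fun k => ?_
    rw [hu k]
    ring
  have hmem : (y : F) ∈ Φ '' K := by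
    rw [← hVc.closure_eq]
    exact mem_closure_of_tendsto htend (Eventually.of_forall fun k => ⟨g k, hmemK k, rfl⟩)
  obtain ⟨g₀, hg₀, hy⟩ := hmem
  exact ⟨g₀, fun j => Set.mem_univ_pi.mp hg₀ j, hy⟩

/-- **`[F : F^q] ≤ q` for a non-archimedean local field** (`q = p^n`, `p` the exponential
characteristic, `ϖ` a uniformizer): every `f ∈ F` is `Σ_{j<q} g_j^q ϖ^j` with `g_j ∈ F`; that
is, `1, ϖ, …, ϖ^{q-1}` span `F` over `F^q` (for `F ≅ 𝔽_q((ϖ))`, `F^p = 𝔽_q((ϖ^p))`).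
Ref: Serre, *Local Fields*, Ch. II §4 (structure of equal-characteristic complete fields). [folklore] -/
theorem exists_frobeniusSum_eq {ϖ : 𝒪[F]} (hϖ : Irreducible ϖ) (f : F) :
    ∃ g : Fin (p ^ n) → F, ∑ j, g j ^ p ^ n * (ϖ : F) ^ (j : ℕ) = f := by
  have hϖ1 : valuation F (ϖ : F) < 1 :=
    Valuation.Integer.not_isUnit_iff_valuation_lt_one.mp hϖ.not_isUnit
  have hϖ0 : (ϖ : F) ≠ 0 := fun h => hϖ.ne_zero (Subtype.ext h)
  by_cases hf : f = 0
  · exact ⟨0, by rw [frobeniusSum_zero, hf]⟩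
  -- scale `f` into `𝒪[F]` by a `q`-th power of `ϖ`
  have hvf : valuation F f ≠ 0 := (Valuation.ne_zero_iff _).mpr hf
  obtain ⟨m, hm⟩ := exists_pow_lt₀ hϖ1 (Units.mk0 (valuation F f)⁻¹ (inv_ne_zero hvf))
  have hy : (ϖ : F) ^ (p ^ n * m) * f ∈ 𝒪[F] := by
    rw [Valuation.mem_integer_iff, map_mul, map_pow]
    have h1 : valuation F (ϖ : F) ^ (p ^ n * m) ≤ valuation F (ϖ : F) ^ m :=
      pow_le_pow_right_of_le_one' hϖ1.le (Nat.le_mul_of_pos_left m (expChar_pow_pos F p n))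
    calc valuation F (ϖ : F) ^ (p ^ n * m) * valuation F f
        ≤ valuation F (ϖ : F) ^ m * valuation F f := mul_le_mul_left h1 _
      _ ≤ (valuation F f)⁻¹ * valuation F f := mul_le_mul_left (by simpa using hm.le) _
      _ = 1 := inv_mul_cancel₀ hvf
  obtain ⟨g, -, hg⟩ := exists_frobeniusSum_eq_of_mem (p := p) (n := n) hϖ ⟨_, hy⟩
  refine ⟨fun j => ((ϖ : F) ^ m)⁻¹ * g j, ?_⟩
  rw [frobeniusSum_mul, hg, inv_pow, ← pow_mul, mul_comm m]
  rw [inv_mul_cancel_left₀ (pow_ne_zero _ hϖ0)]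

/-- **`[F : F^q] ≤ q`**, sum form: with a uniformizer `ϖ`, every `f ∈ F` is
`Σ_{j<q} g_j^q ϖ^j`. [folklore] -/
theorem exists_eq_sum_pow_mul_pow :
    ∃ ϖ : F, ∀ f : F, ∃ g : Fin (p ^ n) → F, f = ∑ j, g j ^ p ^ n * ϖ ^ (j : ℕ) := by
  obtain ⟨ϖ, hϖ⟩ := IsDiscreteValuationRing.exists_irreducible 𝒪[F]
  refine ⟨ϖ, fun f => ?_⟩
  obtain ⟨g, hg⟩ := exists_frobeniusSum_eq (p := p) (n := n) hϖ f
  exact ⟨g, hg.symm⟩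

end Local

end IsNonarchimedeanLocalField

/-! ### Part II: the relative Frobenius of a finite normal extension onto its separable part -/

section ExponentBound

variable (K L : Type*) [Field K] [Field L] [Algebra K L] [IsPurelyInseparable K L]
  [FiniteDimensional K L] (p : ℕ) [ExpChar K p]

/-- For a finite purely inseparable `L/K` of exponential characteristic `p`, the exponent of `L/K`
is at most `log_p [L : K]`: each `a ∈ L` has minimal polynomial `X^{p^e} - c` of degree
`p^e ≤ [L : K]`. [folklore] -/
theorem IsPurelyInseparable.exponent_le_log_finrank :
    IsPurelyInseparable.exponent K L ≤ Nat.log p (Module.finrank K L) := by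
  classical
  unfold IsPurelyInseparable.exponent
  apply Nat.find_le
  intro a
  rcases ‹ExpChar K p› with _ | ⟨hp⟩
  · exact IsPurelyInseparable.surjective_algebraMap_of_isSeparable K L _
  · have hle : IsPurelyInseparable.elemExponent K a ≤ Nat.log p (Module.finrank K L) :=
      Nat.le_log_of_pow_le hp.one_lt
        ((IsPurelyInseparable.minpoly_natDegree_eq' K p a) ▸ minpoly.natDegree_le a)
    refine ⟨IsPurelyInseparable.elemReduct K a ^ p ^
      (Nat.log p (Module.finrank K L) - IsPurelyInseparable.elemExponent K a), ?_⟩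
    rw [ringExpChar.eq K p, map_pow, IsPurelyInseparable.algebraMap_elemReduct_eq' K p a, ← pow_mul,
      ← pow_add, Nat.add_sub_cancel' hle]

omit [IsPurelyInseparable K L] [ExpChar K p] in
/-- `p^{log_p [L:K]} ≤ [L : K]`. [folklore] -/
theorem pow_log_finrank_le : p ^ Nat.log p (Module.finrank K L) ≤ Module.finrank K L :=
  Nat.pow_log_le_self p Module.finrank_pos.ne'

end ExponentBound

namespace IsNonarchimedeanLocalField

section RelFrobenius

/-- **The relative Frobenius of a finite extension of a local field onto a subfield over which it
is purely inseparable is onto.**  Let `F` be a non-archimedean local field of exponential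
characteristic `p`, `E₁/F` a finite subextension of `F̄`, `S₀ ⊆ E₁` an intermediate field with
`E₁/S₀` purely inseparable, and `q = p^r`, `r = log_p [E₁ : S₀]` (so `x^q ∈ S₀` for all
`x ∈ E₁`).  Then `x ↦ x^q : E₁ → S₀` is surjective.  Proof: the `F`-subspace
`W = {x ∈ F̄ : x^q ∈ S₀}` contains `E₁` and is spanned by the `[S₀ : F] · q ≤ [E₁ : F]` elements
`b_i^{1/q} ϖ^{j/q}` (`b_i` an `F`-basis of `S₀`, `ϖ` a uniformizer, `j < q`), because every
coefficient `f ∈ F` is `Σ_j g_j^q ϖ^j` (`exists_eq_sum_pow_mul_pow`, i.e. `[F : F^q] ≤ q`);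
hence `W = E₁`, and `q`-th roots of elements of `S₀` (which exist in `F̄`) lie in `E₁`.
(For `F ≅ 𝔽_q((t))` this is the statement `E₁ = S₀^{1/q}`; it fails for general complete
discretely valued fields of characteristic `p` with `[F : F^p] > p`.) [folklore] -/
theorem iterateFrobenius_surjective {F : Type*} [Field F] [ValuativeRel F] [TopologicalSpace F]
    [IsNonarchimedeanLocalField F] (p : ℕ) [ExpChar F p]
    (E₁ : IntermediateField F (AlgebraicClosure F)) [FiniteDimensional F E₁]
    (S₀ : IntermediateField F E₁) [IsPurelyInseparable S₀ E₁] :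
    Function.Surjective (IsPurelyInseparable.iterateFrobenius S₀ E₁ p
      (IsPurelyInseparable.exponent_le_log_finrank S₀ E₁ p)) := by
  classical
  -- notation
  set r := Nat.log p (Module.finrank S₀ E₁) with hr
  set φ := IsPurelyInseparable.iterateFrobenius S₀ E₁ p
      (IsPurelyInseparable.exponent_le_log_finrank S₀ E₁ p) with hφdef
  have hφ : ∀ x : E₁, ((φ x : S₀) : E₁) = x ^ p ^ r := fun x =>
    IsPurelyInseparable.algebraMap_iterateFrobenius S₀ p
      (IsPurelyInseparable.exponent_le_log_finrank S₀ E₁ p) x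
  haveI : ExpChar (AlgebraicClosure F) p :=
    expChar_of_injective_algebraMap (algebraMap F (AlgebraicClosure F)).injective p
  have hq : 0 < p ^ r := expChar_pow_pos F p r
  -- the image `T` of `S₀` in `F̄` and the subspace `W = {x : x^q ∈ T}`
  let ι₀ : S₀ → AlgebraicClosure F := fun s => ((s : E₁) : AlgebraicClosure F)
  have hι₀_add : ∀ s t, ι₀ (s + t) = ι₀ s + ι₀ t := fun _ _ => rfl
  have hι₀_smul : ∀ (c : F) s, ι₀ (c • s) = algebraMap F _ c * ι₀ s := fun c s => by
    simp only [ι₀, Algebra.smul_def]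
    rfl
  let W : Submodule F (AlgebraicClosure F) :=
    { carrier := {x | ∃ s : S₀, x ^ p ^ r = ι₀ s}
      add_mem' := by
        rintro x y ⟨s, hs⟩ ⟨t, ht⟩
        exact ⟨s + t, by rw [add_pow_expChar_pow, hs, ht, hι₀_add]⟩
      zero_mem' := ⟨0, by rw [zero_pow hq.ne']; rfl⟩
      smul_mem' := by
        rintro c x ⟨s, hs⟩
        refine ⟨(c ^ p ^ r) • s, ?_⟩
        rw [hι₀_smul, Algebra.smul_def, mul_pow, hs, map_pow] }
  have hmemW : ∀ {x : AlgebraicClosure F}, x ∈ W ↔ ∃ s : S₀, x ^ p ^ r = ι₀ s := Iff.rfl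
  -- `E₁ ≤ W`
  let E₁' : Submodule F (AlgebraicClosure F) := Subalgebra.toSubmodule E₁.toSubalgebra
  have hE₁'mem : ∀ {x : AlgebraicClosure F}, x ∈ E₁' ↔ x ∈ E₁ := Iff.rfl
  have hle : E₁' ≤ W := by
    intro x hx
    rw [hE₁'mem] at hx
    refine ⟨φ ⟨x, hx⟩, ?_⟩
    change x ^ p ^ r = (((φ ⟨x, hx⟩ : S₀) : E₁) : AlgebraicClosure F)
    rw [hφ, IntermediateField.coe_pow]
  -- a spanning family of `W` of size `[S₀ : F] · q`
  obtain ⟨ϖ, hϖ⟩ := exists_eq_sum_pow_mul_pow (F := F) p r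
  let b := Module.finBasis F S₀
  choose c hc using fun i => IsAlgClosed.exists_pow_nat_eq (ι₀ (b i)) hq
  obtain ⟨s, hs⟩ := IsAlgClosed.exists_pow_nat_eq (algebraMap F (AlgebraicClosure F) ϖ) hq
  let v : Fin (Module.finrank F S₀) × Fin (p ^ r) → AlgebraicClosure F :=
    fun ij => c ij.1 * s ^ (ij.2 : ℕ)
  have hspan : W ≤ Submodule.span F (Set.range v) := by
    intro x hx
    obtain ⟨t, ht⟩ := (hmemW).mp hx
    -- expand `t` on the basis `b` and each coefficient by `[F : F^q] ≤ q`
    choose g hg using fun i => hϖ (b.repr t i)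
    have hx' : x = ∑ i, ∑ j, g i j • v (i, j) := by
      apply iterateFrobenius_inj (AlgebraicClosure F) p r
      rw [iterateFrobenius_def, iterateFrobenius_def, ht, sum_pow_char_pow]
      conv_lhs => rw [← b.sum_repr t]
      have hι₀_sum : ι₀ (∑ i, b.repr t i • b i) = ∑ i, ι₀ (b.repr t i • b i) := by
        simp only [ι₀, AddSubmonoidClass.coe_finsetSum]
      rw [hι₀_sum]
      refine Finset.sum_congr rfl fun i _ => ?_
      rw [hι₀_smul, hg i, map_sum, Finset.sum_mul, sum_pow_char_pow]
      refine Finset.sum_congr rfl fun j _ => ?_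
      change algebraMap F _ (g i j ^ p ^ r * ϖ ^ (j : ℕ)) * ι₀ (b i) =
        (g i j • (c i * s ^ (j : ℕ))) ^ p ^ r
      rw [Algebra.smul_def, mul_pow, mul_pow, hc i, ← pow_mul, mul_comm (j : ℕ) (p ^ r), pow_mul, hs,
        map_mul, map_pow, map_pow]
      ring
    rw [hx']
    refine Submodule.sum_mem _ fun i _ => Submodule.sum_mem _ fun j _ => ?_
    exact Submodule.smul_mem _ _ (Submodule.subset_span ⟨(i, j), rfl⟩)
  -- dimension count
  haveI : FiniteDimensional F (Submodule.span F (Set.range v)) :=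
    FiniteDimensional.span_of_finite F (Set.finite_range v)
  haveI : FiniteDimensional F W := Submodule.finiteDimensional_of_le hspan
  have hW : Module.finrank F W ≤ Module.finrank F E₁' := by
    calc Module.finrank F W ≤ Module.finrank F (Submodule.span F (Set.range v)) :=
          Submodule.finrank_mono hspan
      _ ≤ Fintype.card (Fin (Module.finrank F S₀) × Fin (p ^ r)) := finrank_range_le_card v
      _ = Module.finrank F S₀ * p ^ r := by simp
      _ ≤ Module.finrank F S₀ * Module.finrank S₀ E₁ :=
          Nat.mul_le_mul_left _ (pow_log_finrank_le S₀ E₁ p)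
      _ = Module.finrank F E₁ := Module.finrank_mul_finrank F S₀ E₁
      _ = Module.finrank F E₁' := by
          rw [Subalgebra.finrank_toSubmodule, IntermediateField.finrank_eq_finrank_subalgebra]
  have hWE : E₁' = W := Submodule.eq_of_le_of_finrank_le hle hW
  -- conclusion
  intro t
  obtain ⟨x, hx⟩ := IsAlgClosed.exists_pow_nat_eq (ι₀ t) hq
  have hxW : x ∈ W := ⟨t, hx⟩
  rw [← hWE, hE₁'mem] at hxW
  refine ⟨⟨x, hxW⟩, ?_⟩
  apply Subtype.val_injective
  apply Subtype.val_injective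
  change (((φ ⟨x, hxW⟩ : S₀) : E₁) : AlgebraicClosure F) = ι₀ t
  rw [hφ, IntermediateField.coe_pow, ← hx]

end RelFrobenius

end IsNonarchimedeanLocalField

/-! ### Part III: transport of the upper filtration along a surjective relative Frobenius -/

section FrobeniusTransport

variable (R : Type*) {K L : Type*} [CommRing R] [Field K] [Field L] [Algebra R K] [Algebra R L]
  [Algebra K L] [IsScalarTower R K L] (S₀ : IntermediateField K L)
  (φ : L →+* S₀) {q : ℕ} (hq : 0 < q) (hφ : ∀ x, ((φ x : S₀) : L) = x ^ q)

include hq hφ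

/-- Along a ring homomorphism `φ : L → S₀` over which `S₀ ⊆ L` is a `q`-th power map
(`φ(x) = x^q` in `L`; a relative Frobenius), integrality over `R` is reflected and preserved:
`x` is integral iff `x^q` is. [folklore] -/
theorem mem_integralClosure_iff_frobenius (x : L) :
    x ∈ integralClosure R L ↔ φ x ∈ integralClosure R S₀ := by
  rw [mem_integralClosure_iff, mem_integralClosure_iff,
    ← isIntegral_algHom_iff (S₀.val.restrictScalars R) Subtype.val_injective]
  change IsIntegral R x ↔ IsIntegral R ((φ x : S₀) : L)
  rw [hφ]
  exact ⟨fun h => h.pow q, fun h => h.of_pow hq⟩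

/-- **A surjective relative Frobenius induces a ring isomorphism of integral closures**
`e : integralClosure R L ≃ integralClosure R S₀` with `e(x) = x^q` in `L` (it is injective as a
ring homomorphism out of a field, and integrality is reflected,
`mem_integralClosure_iff_frobenius`). [folklore] -/
theorem exists_ringEquiv_integralClosure_of_frobenius (hsurj : Function.Surjective φ) :
    ∃ e : integralClosure R L ≃+* integralClosure R S₀, ∀ x, (((e x : integralClosure R S₀) : S₀) : L) =
      (x : L) ^ q := by
  let f : integralClosure R L →+* integralClosure R S₀ :=
    { toFun := fun x => ⟨φ (x : L), (mem_integralClosure_iff_frobenius R S₀ φ hq hφ x).mp x.2⟩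
      map_one' := Subtype.ext (map_one φ)
      map_mul' := fun _ _ => Subtype.ext (map_mul φ _ _)
      map_zero' := Subtype.ext (map_zero φ)
      map_add' := fun _ _ => Subtype.ext (map_add φ _ _) }
  have hf : ∀ x, ((f x : integralClosure R S₀) : S₀) = φ (x : L) := fun _ => rfl
  have hbij : Function.Bijective f := by
    refine ⟨fun x y h => Subtype.ext (φ.injective ?_), fun y => ?_⟩
    · rw [← hf, ← hf, h]
    · obtain ⟨x, hx⟩ := hsurj y
      have hxint : x ∈ integralClosure R L := by
        rw [mem_integralClosure_iff_frobenius R S₀ φ hq hφ x, hx]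
        exact y.2
      exact ⟨⟨x, hxint⟩, Subtype.ext hx⟩
  exact ⟨RingEquiv.ofBijective f hbij, fun x => by rw [← hφ]; rfl⟩

omit hq hφ in
/-- An isomorphism of integral closures which is `x ↦ x^q` in `L` commutes with the Galois
actions along `res : Gal(L/K) → Gal(S₀/K)` (both sides have image `g(x^q) = (g x)^q` in `L`).
[folklore] -/
theorem ringEquiv_integralClosure_smul [Normal K S₀] (e : integralClosure R L ≃+* integralClosure R S₀)
    (he : ∀ x, (((e x : integralClosure R S₀) : S₀) : L) = (x : L) ^ q) (g : L ≃ₐ[K] L)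
    (x : integralClosure R L) :
    e (g • x) = AlgEquiv.restrictNormalHom S₀ g • e x := by
  apply Subtype.ext
  apply Subtype.val_injective
  rw [he, integralClosure.coe_smul, integralClosure.coe_smul]
  simp only [AlgEquiv.smul_def]
  rw [AlgEquiv.restrictNormalHom_apply, he, map_pow]

omit hq in
/-- `res : Gal(L/K) → Gal(S₀/K)` is injective when a relative Frobenius `L → S₀` exists (an
automorphism trivial on `S₀` fixes every `x^q`, hence every `x`). [folklore] -/
theorem restrictNormalHom_injective_of_frobenius [Normal K S₀] :
    Function.Injective (AlgEquiv.restrictNormalHom (F := K) (K₁ := L) S₀) := by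
  have hsmul : ∀ (g : L ≃ₐ[K] L) (x : L),
      ((φ (g x) : S₀) : L) = ((AlgEquiv.restrictNormalHom S₀ g (φ x) : S₀) : L) := fun g x => by
    rw [AlgEquiv.restrictNormalHom_apply, hφ, hφ, map_pow]
  intro g h hgh
  apply AlgEquiv.ext
  intro x
  apply φ.injective
  apply Subtype.val_injective
  rw [hsmul, hsmul, hgh]

/-- **Transport of the upper filtration along a surjective relative Frobenius.**  For `L/K`
normal, `S₀ ⊆ L` normal over `K` with a surjective relative Frobenius `φ : L → S₀`
(`φ(x) = x^q`), and a prime `𝔔` of `integralClosure R L`, the upper ramification groups of `𝔔`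
and of `𝔔 ∩ S₀` correspond under the bijection `res : Gal(L/K) → Gal(S₀/K)`:
`Gal(L/K)^v = res⁻¹ Gal(S₀/K)^v` (transport of structure along the equivariant isomorphism of
pairs `(𝒪_L, 𝔔) ≅ (𝒪_{S₀}, 𝔔 ∩ S₀)`, `upperRamificationSubgroup_comap_ringEquiv`).  Purely
inseparable layers do not change the ramification filtration. [folklore] -/
theorem upperRamificationSubgroup_eq_comap_restrictNormalHom_of_frobenius [Normal K S₀] [Normal K L]
    (hsurj : Function.Surjective φ) (𝔔 : Ideal (integralClosure R L)) [𝔔.IsPrime] (v : ℝ) :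
    upperRamificationSubgroup 𝔔 (L ≃ₐ[K] L) v =
      (upperRamificationSubgroup (𝔔.comap (S₀.integralClosureInclusion R)) (S₀ ≃ₐ[K] S₀) v).comap
        (AlgEquiv.restrictNormalHom S₀) := by
  obtain ⟨e, he⟩ := exists_ringEquiv_integralClosure_of_frobenius R S₀ φ hq hφ hsurj
  have hcomap : (𝔔.comap (S₀.integralClosureInclusion R)).comap e = 𝔔 := by
    ext x
    simp only [Ideal.mem_comap]
    have hx : S₀.integralClosureInclusion R (e x) = x ^ q := by
      apply Subtype.ext
      rw [IntermediateField.coe_integralClosureInclusion, he]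
      rfl
    rw [hx]
    exact Ideal.IsPrime.pow_mem_iff_mem ‹_› q hq
  have hbij : Function.Bijective (AlgEquiv.restrictNormalHom (F := K) (K₁ := L) S₀) :=
    ⟨restrictNormalHom_injective_of_frobenius S₀ φ hφ, AlgEquiv.restrictNormalHom_surjective L⟩
  have h := upperRamificationSubgroup_comap_ringEquiv e (AlgEquiv.restrictNormalHom S₀)
    (ringEquiv_integralClosure_smul R S₀ e he) hbij (𝔔.comap (S₀.integralClosureInclusion R)) v
  rw [hcomap] at h
  exact h

end FrobeniusTransport

/-! ### Part IV: the absolute upper filtration of a local field via Galois layers -/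

section GaloisLayers

open Field GaloisRepresentations.IsNonarchimedeanLocalField

variable {F : Type*} [Field F] [ValuativeRel F] [TopologicalSpace F] [IsNonarchimedeanLocalField F]

/-- **Inseparable layers are controlled by their separable closures.**  For `σ ∈ Γ_F` and
`v : ℝ`, if `σ|_E ∈ Gal(E/F)^v` for every finite *Galois* `E ⊆ F̄`, then `σ ∈ I_F^v`, i.e.
`σ|_{E₁} ∈ Gal(E₁/F)^v` for every finite *normal* `E₁ ⊆ F̄`: with `E_s ⊆ E₁` the separable
closure of `F` (Galois), the relative Frobenius `x ↦ x^{[E₁:E_s]}` is an equivariant ring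
isomorphism `(𝒪_{E₁}, 𝔓_{E₁}) ≅ (𝒪_{E_s}, 𝔓_{E_s})` over `Gal(E₁/F) ≅ Gal(E_s/F)`
(`iterateFrobenius_surjective`, `upperRamificationSubgroup_eq_comap_restrictNormalHom_of_frobenius`),
so `Gal(E₁/F)^v = res⁻¹ Gal(E_s/F)^v`.  (Vacuous bookkeeping in characteristic `0`.) [folklore] -/
theorem mem_absUpperInertia_of_forall_isGalois {v : ℝ} {σ : absoluteGaloisGroup F}
    (h : ∀ (E : IntermediateField F (AlgebraicClosure F)) [FiniteDimensional F E] [IsGalois F E],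
      absRestrictNormalHom E σ ∈
        upperRamificationSubgroup ((absMaximalIdeal F).comap (E.integralClosureToAbsIntegers 𝒪[F]))
          (E ≃ₐ[F] E) v) :
    σ ∈ absUpperInertia F v := by
  rw [mem_absUpperRamificationSubgroup_iff]
  intro E₁ _ _
  -- the separable closure `E_s = lift S₀ ≤ E₁`, a finite Galois layer
  let S₀ : IntermediateField F E₁ := separableClosure F E₁
  have hle : IntermediateField.lift S₀ ≤ E₁ := IntermediateField.lift_le S₀
  haveI : FiniteDimensional F (IntermediateField.lift S₀) :=
    LinearEquiv.finiteDimensional (IntermediateField.liftAlgEquiv S₀).toLinearEquiv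
  haveI : IsGalois F S₀ := separableClosure.isGalois F E₁
  haveI : IsGalois F (IntermediateField.lift S₀) := IsGalois.of_algEquiv (IntermediateField.liftAlgEquiv S₀)
  have hσ := h (IntermediateField.lift S₀)
  -- transport to the copy `restrict hle` of `E_s` inside `E₁`
  haveI : Normal F (IntermediateField.restrict hle) :=
    Normal.of_algEquiv (IntermediateField.restrict_algEquiv hle)
  have hres : IntermediateField.restrict hle = S₀ :=
    IntermediateField.lift_injective E₁ (IntermediateField.lift_restrict hle)
  haveI : IsPurelyInseparable (IntermediateField.restrict hle) E₁ := by
    rw [hres]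
    infer_instance
  rw [upperRamificationSubgroup_layer 𝒪[F] hle (absMaximalIdeal F) v, Subgroup.mem_comap,
    MulEquiv.coe_toMonoidHom, ← restrictNormalHom_restrict_absRestrictNormalHom hle σ] at hσ
  -- the relative Frobenius `E₁ → restrict hle` and the transport of the upper filtration
  haveI : (absMaximalIdeal F).IsMaximal := absMaximalIdeal_isMaximal_holds F
  haveI : ((absMaximalIdeal F).comap (E₁.integralClosureToAbsIntegers 𝒪[F])).IsPrime :=
    Ideal.comap_isPrime _ _
  have hbound := IsPurelyInseparable.exponent_le_log_finrank (IntermediateField.restrict hle) E₁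
    (ringExpChar F)
  rw [upperRamificationSubgroup_eq_comap_restrictNormalHom_of_frobenius 𝒪[F]
      (IntermediateField.restrict hle)
      (IsPurelyInseparable.iterateFrobenius (IntermediateField.restrict hle) E₁ (ringExpChar F) hbound)
      (expChar_pow_pos F (ringExpChar F) _)
      (fun x => IsPurelyInseparable.algebraMap_iterateFrobenius _ (ringExpChar F) hbound x)
      (iterateFrobenius_surjective (ringExpChar F) E₁ (IntermediateField.restrict hle))
      ((absMaximalIdeal F).comap (E₁.integralClosureToAbsIntegers 𝒪[F])) v,
    Subgroup.mem_comap]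
  exact hσ

/-- **`I_F^v ↠ Gal(E/F)^v` from Herbrand's theorem at the finite Galois layers, in every
characteristic.**  For a non-archimedean local field `F`, a finite Galois `E ⊆ F̄` and `v : ℝ`,
the restriction `Γ_F → Gal(E/F)` maps `I_F^v = absUpperInertia F v` onto `Gal(E/F)^v`
(at `𝔓 ∩ E`), granted Herbrand's theorem `herbrand_quotient` for the layers of `F̄` (used only
at finite Galois layers).  The proof is the passage to the limit of
`absUpperRamificationSubgroup_map_eq_of_herbrand_quotient` (compactness of `Γ_F`, all
characteristics: `absoluteGaloisGroup_compactSpace`) run over the finite *Galois* layers, the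
inseparable normal layers being controlled by `mem_absUpperInertia_of_forall_isGalois`.
[cite: SerreLocalFields1979, Ch. IV §3 Prop. 14 and Remark 1] -/
theorem absUpperInertia_map_absRestrictNormalHom_of_herbrand_quotient_of_isGalois
    (hq : ∀ {E E' : IntermediateField F (AlgebraicClosure F)} (hle : E ≤ E'),
      herbrand_quotient 𝒪[F] (IntermediateField.restrict hle))
    (E : IntermediateField F (AlgebraicClosure F)) [FiniteDimensional F E] [IsGalois F E] (v : ℝ) :
    (absUpperInertia F v).map (absRestrictNormalHom E) =
      upperRamificationSubgroup ((absMaximalIdeal F).comap (E.integralClosureToAbsIntegers 𝒪[F]))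
        (E ≃ₐ[F] E) v := by
  haveI : (absMaximalIdeal F).IsMaximal := absMaximalIdeal_isMaximal_holds F
  haveI : Finite (𝒪[F] ⧸ (absMaximalIdeal F).under 𝒪[F]) := by
    rw [under_absMaximalIdeal_holds F]
    exact inferInstanceAs (Finite 𝓀[F])
  haveI : CompactSpace (absoluteGaloisGroup F) := absoluteGaloisGroup_compactSpace F
  apply le_antisymm
  · rintro _ ⟨σ, hσ, rfl⟩
    exact (mem_absUpperRamificationSubgroup_iff.mp hσ) E
  intro g hg
  -- the index type of finite Galois layers above `E`
  let J := {E' : IntermediateField F (AlgebraicClosure F) //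
    E ≤ E' ∧ FiniteDimensional F E' ∧ Normal F E' ∧ Algebra.IsSeparable F E'}
  let S : J → Set (absoluteGaloisGroup F) := fun j =>
    {σ | @absRestrictNormalHom F _ j.1 j.2.2.2.1 σ ∈
        upperRamificationSubgroup ((absMaximalIdeal F).comap (j.1.integralClosureToAbsIntegers 𝒪[F]))
          (j.1 ≃ₐ[F] j.1) v ∧
      absRestrictNormalHom E σ = g}
  have j0 : J := ⟨E, le_rfl, ‹_›, inferInstance, inferInstance⟩
  haveI : Nonempty J := ⟨j0⟩
  -- monotonicity of `S` along `E' ≤ E''` (tower Herbrand, descending)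
  have hmono : ∀ (j j' : J), j.1 ≤ j'.1 → S j' ⊆ S j := by
    rintro ⟨E₁, hE₁, hfd₁, hn₁, hs₁⟩ ⟨E₂, hE₂, hfd₂, hn₂, hs₂⟩ h12 σ ⟨hσ, hσg⟩
    exact ⟨absRestrictNormalHom_mem_upper_of_le 𝒪[F] h12 (absMaximalIdeal F) (hq h12) v σ hσ, hσg⟩
  -- non-emptiness (tower Herbrand, lifting)
  have hne : ∀ j : J, (S j).Nonempty := by
    rintro ⟨E₁, hE₁, hfd₁, hn₁, hs₁⟩
    obtain ⟨σ, hσ, hσg⟩ :=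
      exists_absRestrictNormalHom_mem_upper_of_le 𝒪[F] hE₁ (absMaximalIdeal F) (hq hE₁) v g hg
    exact ⟨σ, hσ, hσg⟩
  -- closedness
  have hclosed : ∀ j : J, IsClosed (S j) := by
    rintro ⟨E₁, hE₁, hfd₁, hn₁, hs₁⟩
    have hc₁ : Continuous (absRestrictNormalHom (K := F) E₁) :=
      (InfiniteGalois.restrictNormalHom_continuous E₁).comp continuous_id
    have hc : Continuous (absRestrictNormalHom (K := F) E) :=
      (InfiniteGalois.restrictNormalHom_continuous E).comp continuous_id
    exact ((isClosed_discrete _).preimage hc₁).inter ((isClosed_discrete {g}).preimage hc)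
  -- directedness
  have hdir : Directed (· ⊇ ·) S := by
    rintro ⟨E₁, hE₁, hfd₁, hn₁, hs₁⟩ ⟨E₂, hE₂, hfd₂, hn₂, hs₂⟩
    refine ⟨⟨E₁ ⊔ E₂, le_sup_of_le_left hE₁, inferInstance, inferInstance, inferInstance⟩, ?_, ?_⟩
    · exact hmono ⟨E₁, hE₁, hfd₁, hn₁, hs₁⟩ _ le_sup_left
    · exact hmono ⟨E₂, hE₂, hfd₂, hn₂, hs₂⟩ _ le_sup_right
  -- compactness
  obtain ⟨σ, hσ⟩ := IsCompact.nonempty_iInter_of_directed_nonempty_isCompact_isClosed S hdir hne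
    (fun j => (hclosed j).isCompact) hclosed
  rw [Set.mem_iInter] at hσ
  refine ⟨σ, ?_, (hσ j0).2⟩
  -- `σ ∈ I_F^v`: checked on Galois layers
  refine mem_absUpperInertia_of_forall_isGalois fun E₁ _ _ => ?_
  have h := (hσ ⟨E ⊔ E₁, le_sup_left, inferInstance, inferInstance, inferInstance⟩).1
  exact absRestrictNormalHom_mem_upper_of_le 𝒪[F] (le_sup_right : E₁ ≤ E ⊔ E₁) (absMaximalIdeal F)
    (hq le_sup_right) v σ h

end GaloisLayers

/-! ### Fact D and the existence of a Serre weight from `herbrand_quotient`, every characteristic -/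

section Holds

open Field GaloisRepresentations.IsNonarchimedeanLocalField

variable (F : Type*) [Field F] [ValuativeRel F] [TopologicalSpace F] [IsNonarchimedeanLocalField F]

/-- **Fact D from the Herbrand leaf, in every characteristic.**  For a non-archimedean local
field `F`, `absUpperInertia_map_absRestrictNormalHom F` (`I_F^v ↠ Gal(E/F)^v` for finite
Galois `E ⊆ F̄`, `v ≥ 0`) follows from Herbrand's theorem at the finite layers of `F̄` (the named
fact `herbrand_quotient`, hypothesis `hq`).  Supersedes the parent's characteristic-`0` version
`absUpperInertia_map_absRestrictNormalHom_of_herbrand_quotient`.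
[cite: SerreLocalFields1979, Ch. IV §3 Prop. 14 and Remark 1] -/
theorem absUpperInertia_map_absRestrictNormalHom_holds_of_herbrand_quotient
    (hq : ∀ {E E' : IntermediateField F (AlgebraicClosure F)} (hle : E ≤ E'),
      herbrand_quotient 𝒪[F] (IntermediateField.restrict hle)) :
    absUpperInertia_map_absRestrictNormalHom F :=
  fun E _ _ v _ => absUpperInertia_map_absRestrictNormalHom_of_herbrand_quotient_of_isGalois hq E v

variable {F}
variable {k : Type*} [Field k] [TopologicalSpace k]

/-- **Existence of a Serre weight from the two remaining named facts, in every characteristic.**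
For every continuous `ρ̄ : Γ_F → GL₂(k)` (`k` discrete) and residue embedding `ι`, one of the
three cases of Serre's recipe applies (`ModPGaloisRep.exists_isSerreWeight ρ ι`), granted
Herbrand's theorem at the finite layers of `F̄` (`herbrand_quotient`, item C9) and the structure
of the characters of `I_F` (`exists_eq_kummerCharacter_pow`, Serre 1972 §1.7 Prop. 5): the
parent's `ModPGaloisRep.exists_isSerreWeight_of` fed with
`absUpperInertia_map_absRestrictNormalHom_holds_of_herbrand_quotient`.
[cite: Serre1987, §2.1 Prop. 1; §2.2–2.4] -/
theorem ModPGaloisRep.exists_isSerreWeight_holds_of_herbrand_quotient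
    (hq : ∀ {E E' : IntermediateField F (AlgebraicClosure F)} (hle : E ≤ E'),
      herbrand_quotient 𝒪[F] (IntermediateField.restrict hle))
    (hA : exists_eq_kummerCharacter_pow F k) (ρ : ModPGaloisRep F k 2)
    (ι : absIntegers 𝒪[F] F ⧸ absMaximalIdeal F →+* k) : ρ.exists_isSerreWeight ι :=
  ρ.exists_isSerreWeight_of (absUpperInertia_map_absRestrictNormalHom_holds_of_herbrand_quotient F hq)
    ι hA

variable (F) in
/-- **Fact D holds: `I_F^v ↠ Gal(E/F)^v`** for every non-archimedean local field `F`, finite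
Galois `E ⊆ F̄` and `v ≥ 0` (`absUpperInertia_map_absRestrictNormalHom F`, Serre, *Local Fields*,
Ch. IV §3, Prop. 14 and Remark 1): `absUpperInertia_map_absRestrictNormalHom_holds_of_herbrand_quotient`
fed with the tree's discharge `herbrand_quotient_holds` of Herbrand's theorem at the finite layers
(`ArtinConductorHerbrandProofs.lean`). [cite: SerreLocalFields1979, Ch. IV §3 Prop. 14 and Remark 1] -/
theorem absUpperInertia_map_absRestrictNormalHom_holds : absUpperInertia_map_absRestrictNormalHom F :=
  absUpperInertia_map_absRestrictNormalHom_holds_of_herbrand_quotient F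
    fun hle => herbrand_quotient_holds 𝒪[F] (IntermediateField.restrict hle)

variable (F) in
/-- **`absInertia_map_isCyclic` holds** (`TameInertia.lean`): a tamely ramified continuous
homomorphism `f : Γ_F → H` into a discrete group has `f(I_F)` cyclic of order prime to `p`
(Serre, *Local Fields*, Ch. IV §2, Cor. 1 of Prop. 7: `G_0/G_1` is cyclic of order prime to `p`);
the parent's `SerreWeightExistence.absInertia_map_isCyclic_of` fed with fact D.
[cite: SerreLocalFields1979, Ch. IV §2 Cor. 1 of Prop. 7] -/
theorem absInertia_map_isCyclic_holds (H : Type*) [Group H] [TopologicalSpace H] :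
    absInertia_map_isCyclic F H :=
  SerreWeightExistence.absInertia_map_isCyclic_of H (absUpperInertia_map_absRestrictNormalHom_holds F)

/-- **Existence of a Serre weight from the characters of `I_F` alone.**  For every continuous
`ρ̄ : Γ_F → GL₂(k)` (`k` discrete) and residue embedding `ι`, one of the three cases of Serre's
recipe applies (`ModPGaloisRep.exists_isSerreWeight ρ ι`), granted only the structure of the
continuous characters of `I_F` of order prime to `p` (`exists_eq_kummerCharacter_pow`,
`TameInertia.lean`; Serre 1972, §1.7 Prop. 5): the parent's `ModPGaloisRep.exists_isSerreWeight_of`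
fed with `absUpperInertia_map_absRestrictNormalHom_holds`.
[cite: Serre1987, §2.1 Prop. 1; §2.2–2.4] -/
theorem ModPGaloisRep.exists_isSerreWeight_holds_of_kummerCharacter
    (hA : exists_eq_kummerCharacter_pow F k) (ρ : ModPGaloisRep F k 2)
    (ι : absIntegers 𝒪[F] F ⧸ absMaximalIdeal F →+* k) : ρ.exists_isSerreWeight ι :=
  ρ.exists_isSerreWeight_of (absUpperInertia_map_absRestrictNormalHom_holds F) ι hA

/-- **`ModPGaloisRep.exists_isSerreWeight` holds** (the named fact of `SerreWeight.lean`; Serre,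
Duke Math. J. 54 (1987), §2.1, Prop. 1 with the normalisations of §2.2–2.4: for every continuous
`ρ̄ : Γ_F → GL₂(k)` over a non-archimedean local field `F`, `k` discrete, and every residue
embedding `ι`, one of the three cases of the weight recipe — level two, level one tame, level one
wild — applies, so `ρ.IsSerreWeight ι m` for some `m`), in every characteristic:
`exists_isSerreWeight_holds_of_kummerCharacter` fed with the tree's discharge
`exists_eq_kummerCharacter_pow_holds` (`TameInertiaKummerProofs.lean`) of the structure of the
characters of `I_F`.  The leaves behind it: Herbrand's theorem (`herbrand_quotient_holds`), the
inseparable layers and `[F : F^q] ≤ q` (this file), `G_1` a `p`-group and `G_0/G_1` cyclic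
(`TameInertiaProofs`, `TameInertiaCyclicProofs`), the Kummer theory of `I_F`
(`UnramifiedKummer`, `TameInertiaKummerProofs`), and the assembly of Prop. 1
(`SerreWeightShapeProofs`). [cite: Serre1987, §2.1 Prop. 1; §2.2–2.4] -/
theorem ModPGaloisRep.exists_isSerreWeight_holds (ρ : ModPGaloisRep F k 2)
    (ι : absIntegers 𝒪[F] F ⧸ absMaximalIdeal F →+* k) : ρ.exists_isSerreWeight ι :=
  ModPGaloisRep.exists_isSerreWeight_holds_of_kummerCharacter (exists_eq_kummerCharacter_pow_holds F k)
    ρ ι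

end Holds

end Literature.NumberTheory.GaloisRepresentations
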